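import Mathlib
import Summits.ABC.ABC.Statement
import Literature.Barriers.ABC.BakerMethodBoundsStewartYuProofs
import Summits.ABC.ABC.Theorems.SoloInformedDoorBRoutes

/-!
# The `p`-adic door: what a better prime-dependence in the approximation bound would give
(solo-ABC-informed, session 3)

Every unconditional upper bound for abc-triples comes from estimates for linear forms in
logarithms, and the exponential shape `log c ≤ F(rad)` with `F` a *power* of the radical
(Stewart–Yu: `log c ≤ κ · rad^{1/3} (log rad)^3`; Pasten, Invent. Math. 236 (2024), Thm 1.4)
is forced by one factor: in the `p`-adic estimate (Yu; clause (ii) of Pasten's Theorem 2.1,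
`Literature.NumberTheory.DiophantineGeometry.Dioph.PastenApproximationBound`) the bound for
`ord_p(1 − ξ) · log p` carries the factor `p / log p`, and summing over the primes of one member
of the triple turns it into `∑_{p ∣ c} p`, a power of the radical.  That this factor is the only
obstruction has been said in print (Baker–Wüstholz, *Logarithmic forms and Diophantine geometry*
(2007), §3.7; Philippon, *Quelques remarques sur des questions d'approximation diophantienne*,
Bull. Austral. Math. Soc. 59 (1999), §3; Waldschmidt, *abc and linear forms in logarithms*, 2014
lecture notes, §§2, 5) but, as far as the seat could find, never as a theorem with the
replacement hypothesis written out.  This file records it for the weakest useful replacement.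

**Door theorem.**  Fix `σ > 0` and `K ≥ 1`, and suppose the `p`-adic clause of Pasten's
Theorem 2.1 over `ℚ` holds with `p / log p` replaced by `p^σ`: for every finite family
`ξ₁, …, ξₙ ∈ ℚ^× ∖ {±1}`, every `ζ = ±1`, `b ∈ ℤⁿ` with `ξ = ζ ∏ ξᵢ^{bᵢ} ≠ 1`, and every prime `p`,
`ord_p(1 − ξ) · log p < Kⁿ · p^σ · log max{e, p·h(ξ)} · ∏ h(ξᵢ)`.
Then for every `ε > 0` there is `C` with `log c ≤ C · rad(abc)^{σ+ε}` for all abc-triples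
(`soloInformed_log_le_rpow_of_padicSigma`); in particular the hypothesis for *every* `σ > 0`
gives subexponential abc, `log c ≪_ε rad(abc)^ε` (`soloInformed_subexpABC_of_padicSigma`),
the rung below polynomial abc of `SoloInformedWall.lean`.  Conversely Pasten's actual bound is
the member `σ = 1` of this family (`soloInformed_padicSigma_one_of_pasten`, constant `K / log 2`),
for which the door theorem returns the classical exponent `1 + ε` of the route through `c` alone
(Stewart–Yu 1991 shape); the three-member balancing of Stewart–Yu 2001 would give `σ/3 + ε`
and is not repeated here, since only `σ → 0` matters for the door.

The proof is the route through `c` with ALL primes of `ab` as generators (threshold `N = 0`):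
`ξ = −a/b`, `1 − ξ = c/b`, so `ν_p(c) log p < (∏_{q ∣ ab} K log q) · p^σ · (log p + log max{e, 2 log c})`
for `p ∣ c`; summing, `log c ≤ (∏_{q ∣ ab} K log q) · 3Y · rad^σ · log rad` with
`Y = log max{e, 2 log c}`; primes eventually beat `K log q / q^δ`
(`soloInformed_exists_prod_mul_log_le`), `log rad ≤ rad^δ/δ`, and the implicit inequality
`y ≤ M log max{e, 2y} ⟹ y ≤ 2M log 4M` (`Literature.Barriers.ABC.le_of_le_mul_log_max`) finish.
No new `Prop` constants are introduced: the hypothesis is written inline.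

Honest status: the hypothesis is OPEN for every `σ < 1` — no `p`-adic linear-forms estimate
with prime-dependence better than `|G_p|`-type factors of size `≍ p` (Yu 2007; Stewart 2013,
`Literature.Barriers.ABC.Stewart2013_lemma5_rat`) is known, uniformly in `p`.  The theorem is a
typed door, not progress on `ABC`. [folklore]

## References

* [Pasten2024] H. Pasten, *The largest prime factor of `n² + 1` and improvements on
  subexponential ABC*, Invent. Math. 236 (2024), 373–385, arXiv:2312.03566 — Theorem 2.1, §§4–5.
* [StewartYu2001] C. L. Stewart, K. Yu, *On the abc conjecture, II*, Duke Math. J. 108 (2001),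
  169–181 — §3.
* [BakerWustholz2007] A. Baker, G. Wüstholz, *Logarithmic forms and Diophantine geometry*,
  CUP 2007 — §3.7.
* [Philippon1999] P. Philippon, Bull. Austral. Math. Soc. 59 (1999) — §3.
-/

noncomputable section

open Finset Real Height
open Literature.NumberTheory.DiophantineGeometry
open Literature.NumberTheory.DiophantineGeometry.Dioph
open Literature.NumberTheory.DiophantineGeometry.Pasten
open Literature.Barriers.ABC

namespace Summit.ABC.ABC.Theorems

/-- **The `p`-adic door (fixed `σ`).** If the `p`-adic clause of Pasten's Theorem 2.1 over `ℚ`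
holds with the factor `p / log p` replaced by `p^σ` (`σ > 0`, constant `K ≥ 1`), then
`log c ≤ C_ε · rad(abc)^{σ+ε}` for every `ε > 0` and every abc-triple.  The hypothesis is open
for every `σ < 1`; for `σ = 1` it is Pasten's theorem (`soloInformed_padicSigma_one_of_pasten`).
[folklore] -/
theorem soloInformed_log_le_rpow_of_padicSigma {σ K : ℝ} (hσ : 0 < σ) (hK : 1 ≤ K)
    (hP : ∀ (ι : Type) [Fintype ι], 0 < Fintype.card ι → ∀ ξ : ι → ℚ,
      (∀ i, ξ i ≠ 0 ∧ ξ i ≠ 1 ∧ ξ i ≠ -1) → ∀ ζ : ℚ, (ζ = 1 ∨ ζ = -1) → ∀ b : ι → ℤ,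
      ζ * ∏ i, ξ i ^ b i ≠ 1 → ∀ p : ℕ, p.Prime →
      (padicValRat p (1 - ζ * ∏ i, ξ i ^ b i) : ℝ) * Real.log p <
        K ^ Fintype.card ι * (p : ℝ) ^ σ *
          Real.log (max (Real.exp 1) (p * logHeight₁ (ζ * ∏ i, ξ i ^ b i))) *
            ∏ i, logHeight₁ (ξ i))
    {ε : ℝ} (hε : 0 < ε) :
    ∃ C : ℝ, 0 < C ∧ ∀ a b c : ℕ, IsABCTriple a b c →
      Real.log c ≤ C * ((rad a b c : ℕ) : ℝ) ^ (σ + ε) := by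
  classical
  set δ : ℝ := ε / 3 with hδdef
  have hδ : 0 < δ := by positivity
  have hK0 : 0 ≤ K := zero_le_one.trans hK
  obtain ⟨C₁, hC₁1, hC₁⟩ := soloInformed_exists_prod_mul_log_le hK0 hδ
  have hC₁0 : 0 < C₁ := lt_of_lt_of_le one_pos hC₁1
  set A₀ : ℝ := max 1 (3 * C₁ / δ) with hA₀def
  have hA₀1 : 1 ≤ A₀ := le_max_left _ _
  have hA₀0 : 0 < A₀ := lt_of_lt_of_le one_pos hA₀1
  have hA₀2 : 3 * C₁ / δ ≤ A₀ := le_max_right _ _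
  have hlog4A₀ : 0 ≤ Real.log (4 * A₀) := Real.log_nonneg (by linarith)
  set C₂ : ℝ := 2 * A₀ * (Real.log (4 * A₀) + (σ + 2 * δ) / δ) with hC₂def
  have hquot : 0 < (σ + 2 * δ) / δ := by positivity
  have hC₂0 : 0 ≤ C₂ := by positivity
  refine ⟨max 1 C₂, lt_of_lt_of_le one_pos (le_max_left _ _), fun a b c h => ?_⟩
  obtain ⟨ha, hb, habc, hcop⟩ := id h
  set R : ℝ := ((rad a b c : ℕ) : ℝ) with hRdef
  have hR2 : (2 : ℝ) ≤ R := by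
    have h2 : 2 ≤ rad a b c := by
      rw [rad_def, Nat.two_le_radical_iff]
      calc 2 ≤ c := by omega
        _ ≤ a * b * c := Nat.le_mul_of_pos_left c (Nat.mul_pos ha hb)
    rw [hRdef]
    exact_mod_cast h2
  have hR1 : (1 : ℝ) ≤ R := by linarith
  have hR0 : (0 : ℝ) < R := by linarith
  have hRθ1 : ∀ θ : ℝ, 0 ≤ θ → 1 ≤ R ^ θ := fun θ hθ => Real.one_le_rpow hR1 hθ
  -- the triple `1 + 1 = 2`
  by_cases h1 : a * b ≤ 1
  · have ha1 : a ≤ 1 := le_trans (Nat.le_mul_of_pos_right a hb) h1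
    have hb1 : b ≤ 1 := le_trans (Nat.le_mul_of_pos_left b ha) h1
    have hc2 : c = 2 := by omega
    have hlog2 : Real.log (c : ℝ) ≤ 1 := by
      rw [hc2]; have := Real.log_two_lt_d9; push_cast; linarith
    calc Real.log (c : ℝ) ≤ 1 := hlog2
      _ ≤ max 1 C₂ * R ^ (σ + ε) :=
          one_le_mul_of_one_le_of_one_le (le_max_left _ _) (hRθ1 (σ + ε) (by linarith))
  have h1' : 1 < a * b := not_le.mp h1
  have hc : 0 < c := by omega
  have habc0 : a * b * c ≠ 0 := (Nat.mul_pos (Nat.mul_pos ha hb) hc).ne'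
  set y : ℝ := Real.log c with hydef
  set Y : ℝ := Real.log (max (Real.exp 1) (2 * y)) with hYdef
  have hY1 : 1 ≤ Y := one_le_log_max_exp _
  have hY0 : 0 < Y := lt_of_lt_of_le one_pos hY1
  set L : ℝ := Real.log R with hLdef
  have hL0 : 0 < L := Real.log_pos (by linarith)
  have hRσ0 : 0 < R ^ σ := Real.rpow_pos_of_pos hR0 _
  have hRδ0 : 0 < R ^ δ := Real.rpow_pos_of_pos hR0 _
  -- Step 1: the route through `c`
  have hF : ∀ p : ℕ, p.Prime → 0 ≤ (p : ℝ) ^ σ := fun p _ => Real.rpow_nonneg (Nat.cast_nonneg p) _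
  have step1 : y ≤ (∏ q ∈ (a * b).primeFactors, K * Real.log q) *
      ∑ p ∈ c.primeFactors, (p : ℝ) ^ σ * (Real.log p + Y) :=
    soloInformed_log_le_route_c_F (F := fun p => (p : ℝ) ^ σ) hK0 hF hP h h1'
  -- Step 2: the generator side, `∏_{q ∣ ab} K log q ≤ C₁ R^δ`
  have hT : ∀ q ∈ (a * b).primeFactors, q.Prime := fun q hq => Nat.prime_of_mem_primeFactors hq
  have step2 : ∏ q ∈ (a * b).primeFactors, K * Real.log q ≤ C₁ * R ^ δ := by
    refine (hC₁ _ hT).trans (mul_le_mul_of_nonneg_left ?_ hC₁0.le)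
    rw [Real.finsetProd_rpow _ _ (fun q _ => Nat.cast_nonneg q)]
    refine Real.rpow_le_rpow (Finset.prod_nonneg fun q _ => Nat.cast_nonneg q) ?_ hδ.le
    have := prod_primeFactors_le_radical ha.ne' hb.ne' (w := c) (by omega)
    rw [hRdef, rad_def]
    exact this
  -- Step 3: the `c` side, `∑_{p ∣ c} p^σ (log p + Y) ≤ 3 Y R^σ L`
  have step3 : ∑ p ∈ c.primeFactors, (p : ℝ) ^ σ * (Real.log p + Y) ≤ 3 * Y * R ^ σ * L := by
    have hterm : ∀ p ∈ c.primeFactors,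
        (p : ℝ) ^ σ * (Real.log p + Y) ≤ 3 * Y * R ^ σ * Real.log p := by
      intro p hp
      have hp' := Nat.prime_of_mem_primeFactors hp
      have hp2 : (2 : ℝ) ≤ p := by exact_mod_cast hp'.two_le
      have hℓ : 1 / 2 ≤ Real.log p := by
        have := Real.log_two_gt_d9
        have := Real.log_le_log (by norm_num : (0 : ℝ) < 2) hp2
        linarith
      have hadd : Real.log p + Y ≤ 3 * Y * Real.log p := by
        nlinarith [mul_nonneg (sub_nonneg.mpr hℓ) (by linarith : (0 : ℝ) ≤ 3 * Y - 1)]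
      have hpR : (p : ℝ) ^ σ ≤ R ^ σ := by
        refine Real.rpow_le_rpow (Nat.cast_nonneg p) ?_ hσ.le
        rw [hRdef]
        exact_mod_cast prime_le_rad hp'
          ((Nat.dvd_of_mem_primeFactors hp).trans (Dvd.intro_left _ rfl)) habc0
      have hpσ0 : 0 ≤ (p : ℝ) ^ σ := Real.rpow_nonneg (Nat.cast_nonneg p) _
      have h3Yℓ : 0 ≤ 3 * Y * Real.log p := by positivity
      calc (p : ℝ) ^ σ * (Real.log p + Y) ≤ (p : ℝ) ^ σ * (3 * Y * Real.log p) :=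
            mul_le_mul_of_nonneg_left hadd hpσ0
        _ ≤ R ^ σ * (3 * Y * Real.log p) := mul_le_mul_of_nonneg_right hpR h3Yℓ
        _ = 3 * Y * R ^ σ * Real.log p := by ring
    have hsumlog : ∑ p ∈ c.primeFactors, Real.log (p : ℝ) ≤ L := by
      have hne : ∀ p ∈ c.primeFactors, ((p : ℕ) : ℝ) ≠ 0 := fun p hp => by
        exact_mod_cast (Nat.prime_of_mem_primeFactors hp).ne_zero
      rw [← Real.log_prod hne]
      refine Real.log_le_log (Finset.prod_pos fun p hp => ?_) ?_
      · exact_mod_cast (Nat.prime_of_mem_primeFactors hp).pos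
      · have := prod_primeFactors_le_radical (u := c) (v := 1) hc.ne' one_ne_zero
          (w := a * b) (Nat.mul_pos ha hb).ne'
        rw [mul_one, show c * (a * b) = a * b * c by ring] at this
        rw [hRdef, rad_def]
        exact this
    calc ∑ p ∈ c.primeFactors, (p : ℝ) ^ σ * (Real.log p + Y)
        ≤ ∑ p ∈ c.primeFactors, 3 * Y * R ^ σ * Real.log p := Finset.sum_le_sum hterm
      _ = 3 * Y * R ^ σ * ∑ p ∈ c.primeFactors, Real.log (p : ℝ) := by rw [Finset.mul_sum]
      _ ≤ 3 * Y * R ^ σ * L := mul_le_mul_of_nonneg_left hsumlog (by positivity)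
  -- Step 4: `log R ≤ R^δ / δ`, and the bound `y ≤ M · Y`
  have step4 : L ≤ R ^ δ / δ := Real.log_le_rpow_div hR0.le hδ
  set M : ℝ := A₀ * R ^ (σ + 2 * δ) with hMdef
  have hRσδ1 : 1 ≤ R ^ (σ + 2 * δ) := hRθ1 (σ + 2 * δ) (by linarith)
  have hRσδ0 : 0 < R ^ (σ + 2 * δ) := lt_of_lt_of_le one_pos hRσδ1
  have hM1 : 1 ≤ M := one_le_mul_of_one_le_of_one_le hA₀1 hRσδ1
  have hRpow : R ^ δ * R ^ σ * (R ^ δ / δ) = R ^ (σ + 2 * δ) / δ := by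
    rw [show σ + 2 * δ = δ + σ + δ by ring, Real.rpow_add hR0, Real.rpow_add hR0]
    ring
  have hsum0 : 0 ≤ ∑ p ∈ c.primeFactors, (p : ℝ) ^ σ * (Real.log p + Y) :=
    Finset.sum_nonneg fun p hp => mul_nonneg (Real.rpow_nonneg (Nat.cast_nonneg p) _)
      (add_nonneg (Real.log_nonneg (by exact_mod_cast (Nat.prime_of_mem_primeFactors hp).one_lt.le))
        hY0.le)
  have step5 : y ≤ M * Y := by
    calc y ≤ (∏ q ∈ (a * b).primeFactors, K * Real.log q) *
          ∑ p ∈ c.primeFactors, (p : ℝ) ^ σ * (Real.log p + Y) := step1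
      _ ≤ (C₁ * R ^ δ) * (3 * Y * R ^ σ * L) := mul_le_mul step2 step3 hsum0 (by positivity)
      _ ≤ (C₁ * R ^ δ) * (3 * Y * R ^ σ * (R ^ δ / δ)) := by
          apply mul_le_mul_of_nonneg_left _ (by positivity)
          exact mul_le_mul_of_nonneg_left step4 (by positivity)
      _ = 3 * C₁ * Y * (R ^ δ * R ^ σ * (R ^ δ / δ)) := by ring
      _ = 3 * C₁ * Y * (R ^ (σ + 2 * δ) / δ) := by rw [hRpow]
      _ = (3 * C₁ / δ) * (R ^ (σ + 2 * δ) * Y) := by ring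
      _ ≤ A₀ * (R ^ (σ + 2 * δ) * Y) := mul_le_mul_of_nonneg_right hA₀2 (by positivity)
      _ = M * Y := by rw [hMdef]; ring
  -- Step 5: the implicit inequality
  have step6 : y ≤ 2 * M * Real.log (4 * M) := le_of_le_mul_log_max hM1 step5
  have step7 : Real.log (4 * M) ≤ (Real.log (4 * A₀) + (σ + 2 * δ) / δ) * R ^ δ := by
    have hsplit : Real.log (4 * M) = Real.log (4 * A₀) + (σ + 2 * δ) * L := by
      rw [hMdef, show 4 * (A₀ * R ^ (σ + 2 * δ)) = (4 * A₀) * R ^ (σ + 2 * δ) by ring,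
        Real.log_mul (by positivity) hRσδ0.ne', Real.log_rpow hR0]
    rw [hsplit]
    have hRδ1 : 1 ≤ R ^ δ := hRθ1 δ hδ.le
    have e1 : Real.log (4 * A₀) ≤ Real.log (4 * A₀) * R ^ δ :=
      le_mul_of_one_le_right hlog4A₀ hRδ1
    have e2 : (σ + 2 * δ) * L ≤ (σ + 2 * δ) / δ * R ^ δ := by
      rw [div_mul_eq_mul_div, mul_div_assoc]
      exact mul_le_mul_of_nonneg_left step4 (by linarith)
    linarith
  have hfin : y ≤ C₂ * R ^ (σ + ε) := by
    have hM0 : 0 ≤ 2 * M := by linarith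
    calc y ≤ 2 * M * Real.log (4 * M) := step6
      _ ≤ 2 * M * ((Real.log (4 * A₀) + (σ + 2 * δ) / δ) * R ^ δ) :=
          mul_le_mul_of_nonneg_left step7 hM0
      _ = C₂ * (R ^ (σ + 2 * δ) * R ^ δ) := by rw [hMdef, hC₂def]; ring
      _ = C₂ * R ^ (σ + ε) := by
          rw [← Real.rpow_add hR0]
          congr 2
          rw [hδdef]; ring
  calc y ≤ C₂ * R ^ (σ + ε) := hfin
    _ ≤ max 1 C₂ * R ^ (σ + ε) :=
        mul_le_mul_of_nonneg_right (le_max_right _ _) (Real.rpow_nonneg hR0.le _)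

/-- **Subexponential abc through the door.** If the `p`-adic clause of Pasten's Theorem 2.1
over `ℚ` holds with `p / log p` replaced by `p^σ` for EVERY `σ > 0` (constants `K_σ ≥ 1`), then
`log c ≪_ε rad(abc)^ε` for all abc-triples — the rung "subexponential abc" below polynomial abc
and `ABC` (`soloInformed_subexpABC_of_abc` in `SoloInformedWall.lean`).  The hypothesis is open.
[folklore] -/
theorem soloInformed_subexpABC_of_padicSigma
    (h : ∀ σ : ℝ, 0 < σ → ∃ K : ℝ, 1 ≤ K ∧ ∀ (ι : Type) [Fintype ι], 0 < Fintype.card ι →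
      ∀ ξ : ι → ℚ, (∀ i, ξ i ≠ 0 ∧ ξ i ≠ 1 ∧ ξ i ≠ -1) → ∀ ζ : ℚ, (ζ = 1 ∨ ζ = -1) →
      ∀ b : ι → ℤ, ζ * ∏ i, ξ i ^ b i ≠ 1 → ∀ p : ℕ, p.Prime →
      (padicValRat p (1 - ζ * ∏ i, ξ i ^ b i) : ℝ) * Real.log p <
        K ^ Fintype.card ι * (p : ℝ) ^ σ *
          Real.log (max (Real.exp 1) (p * logHeight₁ (ζ * ∏ i, ξ i ^ b i))) *
            ∏ i, logHeight₁ (ξ i)) :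
    ∀ ε : ℝ, 0 < ε → ∃ K : ℝ, 0 < K ∧ ∀ a b c : ℕ, IsABCTriple a b c →
      Real.log (c : ℝ) ≤ K * ((rad a b c : ℕ) : ℝ) ^ ε := by
  intro ε hε
  obtain ⟨K, hK, hP⟩ := h (ε / 2) (half_pos hε)
  obtain ⟨C, hC, hC'⟩ := soloInformed_log_le_rpow_of_padicSigma (half_pos hε) hK hP (half_pos hε)
  refine ⟨C, hC, fun a b c habc => ?_⟩
  have := hC' a b c habc
  rwa [add_halves] at this

/-- **The known member of the family.** Pasten's approximation bound (`p`-adic clause, factor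
`p / log p`) implies the hypothesis of the door theorem with `σ = 1` and constant `K / log 2`
(`p / log p ≤ p / log 2` and `(1/log 2)ⁿ ≥ 1/log 2` for `n ≥ 1`).  So the door family
interpolates between what is proved (`σ = 1`) and what would give subexponential abc (`σ → 0`).
[cite: Pasten2024, Theorem 2.1] -/
theorem soloInformed_padicSigma_one_of_pasten {K : ℝ} (hK : 1 ≤ K)
    (hP : PastenApproximationBound K) :
    ∀ (ι : Type) [Fintype ι], 0 < Fintype.card ι → ∀ ξ : ι → ℚ,
      (∀ i, ξ i ≠ 0 ∧ ξ i ≠ 1 ∧ ξ i ≠ -1) → ∀ ζ : ℚ, (ζ = 1 ∨ ζ = -1) → ∀ b : ι → ℤ,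
      ζ * ∏ i, ξ i ^ b i ≠ 1 → ∀ p : ℕ, p.Prime →
      (padicValRat p (1 - ζ * ∏ i, ξ i ^ b i) : ℝ) * Real.log p <
        (K / Real.log 2) ^ Fintype.card ι * (p : ℝ) ^ (1 : ℝ) *
          Real.log (max (Real.exp 1) (p * logHeight₁ (ζ * ∏ i, ξ i ^ b i))) *
            ∏ i, logHeight₁ (ξ i) := by
  intro ι _ hι ξ hξ ζ hζ b hb p hp
  obtain ⟨-, hN⟩ := hP ι hι ξ hξ ζ hζ b hb
  have h := hN p hp
  have hl2 : 0 < Real.log 2 := Real.log_pos one_lt_two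
  have hl2' : Real.log 2 ≤ 1 := by have := Real.log_two_lt_d9; linarith
  have hp2 : (2 : ℝ) ≤ p := by exact_mod_cast hp.two_le
  have hlogp : Real.log 2 ≤ Real.log p := Real.log_le_log two_pos hp2
  have hp0 : (0 : ℝ) ≤ p := by linarith
  have hK0 : 0 ≤ K := zero_le_one.trans hK
  have hn1 : 1 ≤ Fintype.card ι := hι
  have h1 : (p : ℝ) / Real.log p ≤ (p : ℝ) / Real.log 2 := by
    rw [div_eq_mul_one_div, div_eq_mul_one_div (p : ℝ)]
    exact mul_le_mul_of_nonneg_left (one_div_le_one_div_of_le hl2 hlogp) hp0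
  have hpow : Real.log 2 ^ Fintype.card ι ≤ Real.log 2 := by
    calc Real.log 2 ^ Fintype.card ι ≤ Real.log 2 ^ 1 := pow_le_pow_of_le_one hl2.le hl2' hn1
      _ = Real.log 2 := pow_one _
  have h2 : K ^ Fintype.card ι / Real.log 2 ≤ (K / Real.log 2) ^ Fintype.card ι := by
    rw [div_pow, div_eq_mul_one_div, div_eq_mul_one_div (K ^ Fintype.card ι)]
    exact mul_le_mul_of_nonneg_left (one_div_le_one_div_of_le (pow_pos hl2 _) hpow)
      (pow_nonneg hK0 _)
  have hY : 0 ≤ Real.log (max (Real.exp 1) (p * logHeight₁ (ζ * ∏ i, ξ i ^ b i))) :=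
    zero_le_one.trans (one_le_log_max_exp _)
  have hH : 0 ≤ ∏ i, logHeight₁ (ξ i) := Finset.prod_nonneg fun i _ => zero_le_logHeight₁ _
  have key : K ^ Fintype.card ι * ((p : ℝ) / Real.log p) ≤
      (K / Real.log 2) ^ Fintype.card ι * (p : ℝ) ^ (1 : ℝ) := by
    rw [Real.rpow_one]
    calc K ^ Fintype.card ι * ((p : ℝ) / Real.log p)
        ≤ K ^ Fintype.card ι * ((p : ℝ) / Real.log 2) :=
          mul_le_mul_of_nonneg_left h1 (pow_nonneg hK0 _)
      _ = K ^ Fintype.card ι / Real.log 2 * p := by ring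
      _ ≤ (K / Real.log 2) ^ Fintype.card ι * p := mul_le_mul_of_nonneg_right h2 hp0
  calc (padicValRat p (1 - ζ * ∏ i, ξ i ^ b i) : ℝ) * Real.log p
      < K ^ Fintype.card ι * (p / Real.log p) *
          Real.log (max (Real.exp 1) (p * logHeight₁ (ζ * ∏ i, ξ i ^ b i))) *
            ∏ i, logHeight₁ (ξ i) := h
    _ ≤ (K / Real.log 2) ^ Fintype.card ι * (p : ℝ) ^ (1 : ℝ) *
          Real.log (max (Real.exp 1) (p * logHeight₁ (ζ * ∏ i, ξ i ^ b i))) *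
            ∏ i, logHeight₁ (ξ i) :=
        mul_le_mul_of_nonneg_right (mul_le_mul_of_nonneg_right key hY) hH

end Summit.ABC.ABC.Theorems

end
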